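import Summits.RiemannHypothesis.RiemannHypothesis.Theorems.AsymptoticCriticalLine.Negative.Ladder

/-!
# Line `interior-edge-split`: its two registered stubs under mutation (negative lemmas, drefute)

Deep-refute pass (refuter-drefute-stmt-RiemannHypothesis-2063-0, 2026-08-16) on the STUB SET of the
picked line `Cruxes/AsymptoticCriticalLine/Lines/interior-edge-split.lean` (skeleton sha
`fcef9e5be736`, lead prover-line-stmt-RiemannHypothesis-2063-0) for the crux
`RuelleBand.AsymptoticCriticalLine` ("ACL", stmt-RiemannHypothesis-2063); complements the
disprover's `StubProfile.lean` (status `stubs_of_riemannHypothesis`, forms `stub1_iff_noInteriorBandShape`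
/ `stub1_iff_plain` / `eventually_zeroFree_of_window_finite`, and the model profile), which is not
repeated:

* STUB 1 `stub_noRightInteriorBand`:
  `∀ σ₀, 1/2 < σ₀ → σ₀ < 1 → ∃ ε > 0, {s | ζ s = 0 ∧ 0 < Re s ∧ Re s < 1 ∧ |Re s − σ₀| < ε}.Finite`
  (= `StubProfile.RightInteriorShape riemannZeta`, `Iff.rfl`);
* STUB 2 `stub_edgeZeroFreeStrip`:
  `∃ δ > 0, ∀ s, ζ s = 0 → 1 − δ < Re s → Re s < 1 → False` — VERBATIM route Strip's crux
  `StripZeroFreeStrip` (stmt-RiemannHypothesis-10660), the conclusion of the route's support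
  `AsymptoticToZeroFreeStrip` (stmt-10740), `Split.EdgeZeroFreeShape riemannZeta` and
  `∃ δ > 0, QuasiRiemannHypothesis (1 − δ)` (all four `Iff.rfl`, checked in the seat's scratch file).

Both stubs are RH-implied and open: NO KILL, no misstatement (`aesop`/`simp` close neither;
binder hypotheses satisfiable; no junk operator: `1 / 2 : ℝ`, `|·|` on `ℝ`, Mathlib's junk point
`ζ 1` excluded by `Re s < 1`). Recorded here, `sorry`-free over the lane files `BandForms` and
`Ladder`: the load carried by each clause and the refuted / calibrated strengthenings.

STUB 1.
  - `1/2 < σ₀` LOAD-BEARING — `noRightInteriorBand_false_without_halfLt` (with `1/2 ≤ σ₀` the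
    abscissa `σ₀ = 1/2` is admitted; Hardy's critical zeros, PROVED in tree);
  - `σ₀ < 1` IS THE SPLIT — `noRightInteriorBand_without_ltOne_iff_acl`: drop it and stub 1 is
    EQUIVALENT TO THE CRUX (compactness of `[1/2 + ε, 1]`, `rightBandSet_finite_of_windows`); the
    one missing abscissa `σ₀ = 1` is exactly stub 2 (`windowOne_iff_edgeZeroFreeStrip`): crux =
    matrix on `(1/2, 1]`, stub 1 = on `(1/2, 1)`, stub 2 = at `{1}` — the bound is real, not costume;
  - `0 < ε` carries the content (`window_eq_empty_of_nonpos`);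
  - COMPACT-INTERVAL FORM `noRightInteriorBand_iff_Icc`: stub 1 ⟺ every `[a, b] ⊂ (1/2, 1)` carries
    finitely many zeros — the output shape of an annulus / three-circle engine;
  - the UNIFORM strengthening (one `ε` for all `σ₀`) is FALSE (`not_noRightInteriorBand_uniform`,
    Hardy): `ε(σ₀) → 0` as `σ₀ ↓ 1/2` is forced;
  - sharpening "finitely many" to "none" is RH on the nose (`emptyWindows_iff_riemannHypothesis`,
    through the tree's PROVED `quasiRiemannHypothesis_one_half_iff_holds`): the whole distance from
    stub 1 to RH is the finite-exception relaxation, window by window;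
  - single abscissa: `window_finite_iff_bounded` and `window_finite_of_eventually_zeroFree`, the
    converse of `StubProfile.eventually_zeroFree_of_window_finite` — one instance of stub 1 ⟺ an
    EVENTUAL ZERO-FREE VERTICAL NEIGHBOURHOOD of `σ₀`, open at every `σ₀ ∈ (1/2, 1)`.
STUB 2. `Re s < 1` REDUNDANT (`edgeZeroFreeStrip_iff_without_reLtOne`, Mathlib
`riemannZeta_ne_zero_of_one_le_re` covers `s = 1`); `0 < δ` carries the content
(`edgeStrip_of_nonpos`); TIGHT PARAMETER RANGE: every admissible `δ` is `≤ 1/2`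
(`edgeStrip_delta_le_half`, Hardy) and `δ = 1/2` is RH itself (`edgeStrip_half_iff_riemannHypothesis`),
so stub 2 reads "quasi-RH at SOME abscissa `1 − δ ∈ [1/2, 1)`", each instance open; weakening
"no zero" to "finitely many zeros near the edge" changes nothing (`edgeFinite_iff_edgeZeroFreeStrip`)
— there is no finite-exception rung on the edge side (contrast stub 1, where finiteness is only
EVENTUAL zero-freeness).

THE GLUE NEEDS BOTH (§3): for the abstract zero set `e_n = 1 − 2^{−(n+2)} + in` (zeros marching
to the 1-line) stub 1's shape holds and stub 2's fails (`exists_rightInterior_and_not_edge`); with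
`SplitWitness.exists_edge_and_not_noInterior` (`ζ₃`: stub 2 true, stub 1 false) neither hypothesis
of `AsymptoticCriticalLine_of` can be dropped for a general zero set. Numerics cannot touch either
stub (RH verified to height `3·10¹²`, Platt–Trudgian 2021).
-/

noncomputable section

namespace Summit.RiemannHypothesis.RiemannHypothesis.Theorems.AsymptoticCriticalLine.Negative

open Complex Set
open Summit.RiemannHypothesis.RiemannHypothesis.Theses.RuelleBand (AsymptoticCriticalLine)

/-! ## 0. Hardy's critical zeros sit in every window that reaches the critical line -/

/-- The critical zeros `1/2 + it`, as points of `ℂ`, form an infinite set (Hardy 1914, PROVED in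
tree: `hardy_infinite_zeros_on_critical_line_holds`). [folklore] -/
theorem critZeros_infinite :
    ((fun t : ℝ => (1 : ℂ) / 2 + t * I) '' {t : ℝ | riemannZeta (1 / 2 + t * I) = 0}).Infinite := by
  have hH : {t : ℝ | riemannZeta (1 / 2 + t * I) = 0}.Infinite :=
    Literature.NumberTheory.LFunctions.hardy_infinite_zeros_on_critical_line_holds
  have hinj : Set.InjOn (fun t : ℝ => (1 : ℂ) / 2 + t * I)
      {t : ℝ | riemannZeta (1 / 2 + t * I) = 0} := by
    intro a _ b _ hab
    have h' := congrArg Complex.im hab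
    simpa only [critPt_im] using h'
  exact hH.image hinj

/-- A window reaching the critical line (`|1/2 − σ₀| < ε`) holds all critical zeros. [folklore] -/
theorem window_infinite_of_reaches_half {σ₀ ε : ℝ} (h : |1 / 2 - σ₀| < ε) :
    {s : ℂ | riemannZeta s = 0 ∧ 0 < s.re ∧ s.re < 1 ∧ |s.re - σ₀| < ε}.Infinite := by
  refine critZeros_infinite.mono ?_
  rintro _ ⟨t, ht, rfl⟩
  refine ⟨ht, ?_, ?_, ?_⟩
  · rw [critPt_re]; norm_num
  · rw [critPt_re]; norm_num
  · rw [critPt_re]; exact h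

/-- At radius `ε ≤ 0` every window is empty: the clause `0 < ε` carries the content of stub 1.
[folklore] -/
theorem window_eq_empty_of_nonpos (Z : ℂ → ℂ) (σ₀ : ℝ) {ε : ℝ} (hε : ε ≤ 0) :
    {s : ℂ | Z s = 0 ∧ 0 < s.re ∧ s.re < 1 ∧ |s.re - σ₀| < ε} = ∅ := by
  refine eq_empty_iff_forall_notMem.2 ?_
  rintro s ⟨-, -, -, hs⟩
  exact (lt_irrefl (0 : ℝ)) ((abs_nonneg _).trans_lt (hs.trans_le hε))

/-! ## 1. Stub 1 `stub_noRightInteriorBand` -/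

/-- `1/2 < σ₀` is LOAD-BEARING: with `1/2 ≤ σ₀` the abscissa `σ₀ = 1/2` is admitted and every
window around it holds Hardy's infinitely many critical zeros. [folklore] -/
theorem noRightInteriorBand_false_without_halfLt :
    ¬ ∀ σ₀ : ℝ, 1 / 2 ≤ σ₀ → σ₀ < 1 → ∃ ε : ℝ, 0 < ε ∧
        {s : ℂ | riemannZeta s = 0 ∧ 0 < s.re ∧ s.re < 1 ∧ |s.re - σ₀| < ε}.Finite := by
  intro h
  obtain ⟨ε, hε, hfin⟩ := h (1 / 2) le_rfl (by norm_num)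
  exact window_infinite_of_reaches_half (σ₀ := 1 / 2) (ε := ε) (by simpa using hε) hfin

/-- Finite windows around every point of the compact interval `[1/2 + ε, 1]` make the right
half-band `rightBandSet ε = {ζ = 0, 1/2 + ε ≤ Re s < 1}` finite (`IsCompact.elim_nhds_subcover`;
the glue of the line with the edge handled by windows instead of a zero-free strip). [folklore] -/
theorem rightBandSet_finite_of_windows {ε : ℝ} (hε : 0 < ε)
    (h : ∀ x ∈ Icc (1 / 2 + ε) 1, ∃ r : ℝ, 0 < r ∧
      {s : ℂ | riemannZeta s = 0 ∧ 0 < s.re ∧ s.re < 1 ∧ |s.re - x| < r}.Finite) :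
    (rightBandSet ε).Finite := by
  choose! r hr hfin using h
  obtain ⟨t, htK, hcover⟩ := (isCompact_Icc (a := 1 / 2 + ε) (b := 1)).elim_nhds_subcover
    (fun x => Ioo (x - r x) (x + r x))
    (fun x hx => Ioo_mem_nhds (by linarith [hr x hx]) (by linarith [hr x hx]))
  refine ((t.finite_toSet).biUnion fun x hx => hfin x (htK x hx)).subset ?_
  intro s hs
  obtain ⟨hz, hre, hlt⟩ := hs
  have hsK : s.re ∈ Icc (1 / 2 + ε) 1 := ⟨hre, hlt.le⟩
  obtain ⟨x, hxt, hsx⟩ := mem_iUnion₂.1 (hcover hsK)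
  refine mem_iUnion₂.2 ⟨x, hxt, hz, by linarith, hlt, ?_⟩
  rw [abs_sub_lt_iff]
  exact ⟨by linarith [hsx.2], by linarith [hsx.1]⟩

/-- `σ₀ < 1` IS THE SPLIT: drop it — windows demanded at every `σ₀ > 1/2`, the edge `σ₀ = 1`
included — and stub 1 becomes EQUIVALENT TO THE CRUX. The upper bound is the only thing that
separates the interior stub from `AsymptoticCriticalLine`; the one missing abscissa `σ₀ = 1` is
exactly stub 2 (`windowOne_iff_edgeZeroFreeStrip`). [folklore] -/
theorem noRightInteriorBand_without_ltOne_iff_acl :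
    (∀ σ₀ : ℝ, 1 / 2 < σ₀ → ∃ ε : ℝ, 0 < ε ∧
        {s : ℂ | riemannZeta s = 0 ∧ 0 < s.re ∧ s.re < 1 ∧ |s.re - σ₀| < ε}.Finite) ↔
      AsymptoticCriticalLine := by
  constructor
  · intro h
    refine acl_iff_rightBand.2 fun ε hε => rightBandSet_finite_of_windows hε fun x hx => ?_
    exact h x (by linarith [hx.1])
  · intro h σ₀ hσ
    refine ⟨(σ₀ - 1 / 2) / 2, by linarith,
      (acl_iff_bandSet.1 h ((σ₀ - 1 / 2) / 2) (by linarith)).subset ?_⟩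
    rintro s ⟨hz, h0, h1, hs⟩
    refine ⟨hz, h0, h1, ?_⟩
    rw [abs_sub_lt_iff] at hs
    rw [abs_of_pos (by linarith [hs.2])]
    linarith [hs.2]

/-- COMPACT-INTERVAL FORM (the shape an annulus / three-circle engine outputs): stub 1 ⟺ every
closed interval `[a, b] ⊂ (1/2, 1)` of abscissae carries only finitely many zeros
(`IsCompact.elim_nhds_subcover` one way, a window of radius `min (σ₀ − 1/2) (1 − σ₀) / 2` the
other). [folklore] -/
theorem noRightInteriorBand_iff_Icc :
    (∀ σ₀ : ℝ, 1 / 2 < σ₀ → σ₀ < 1 → ∃ ε : ℝ, 0 < ε ∧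
        {s : ℂ | riemannZeta s = 0 ∧ 0 < s.re ∧ s.re < 1 ∧ |s.re - σ₀| < ε}.Finite) ↔
      ∀ a b : ℝ, 1 / 2 < a → b < 1 →
        {s : ℂ | riemannZeta s = 0 ∧ a ≤ s.re ∧ s.re ≤ b}.Finite := by
  constructor
  · intro h a b ha hb
    have hloc : ∀ x ∈ Icc a b, ∃ r : ℝ, 0 < r ∧
        {s : ℂ | riemannZeta s = 0 ∧ 0 < s.re ∧ s.re < 1 ∧ |s.re - x| < r}.Finite :=
      fun x hx => h x (by linarith [hx.1]) (by linarith [hx.2])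
    choose! r hr hfin using hloc
    obtain ⟨t, htK, hcover⟩ := (isCompact_Icc (a := a) (b := b)).elim_nhds_subcover
      (fun x => Ioo (x - r x) (x + r x))
      (fun x hx => Ioo_mem_nhds (by linarith [hr x hx]) (by linarith [hr x hx]))
    refine ((t.finite_toSet).biUnion fun x hx => hfin x (htK x hx)).subset ?_
    rintro s ⟨hz, hsa, hsb⟩
    obtain ⟨x, hxt, hsx⟩ := mem_iUnion₂.1 (hcover ⟨hsa, hsb⟩)
    refine mem_iUnion₂.2 ⟨x, hxt, hz, by linarith, by linarith, ?_⟩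
    rw [abs_sub_lt_iff]
    exact ⟨by linarith [hsx.2], by linarith [hsx.1]⟩
  · intro h σ₀ h0 h1
    have hm0 : 0 < min (σ₀ - 1 / 2) (1 - σ₀) := lt_min (by linarith) (by linarith)
    have hm1 : min (σ₀ - 1 / 2) (1 - σ₀) ≤ σ₀ - 1 / 2 := min_le_left _ _
    have hm2 : min (σ₀ - 1 / 2) (1 - σ₀) ≤ 1 - σ₀ := min_le_right _ _
    refine ⟨min (σ₀ - 1 / 2) (1 - σ₀) / 2, by linarith,
      (h (σ₀ - min (σ₀ - 1 / 2) (1 - σ₀) / 2) (σ₀ + min (σ₀ - 1 / 2) (1 - σ₀) / 2)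
        (by linarith) (by linarith)).subset ?_⟩
    rintro s ⟨hz, -, -, hs⟩
    rw [abs_sub_lt_iff] at hs
    exact ⟨hz, by linarith [hs.2], by linarith [hs.1]⟩

/-- The UNIFORM strengthening (one radius `ε` for all abscissae) is FALSE: the window around
`σ₀ = 1/2 + min (ε/2) (1/4)` reaches the critical line (Hardy). So `ε(σ₀) → 0` as `σ₀ ↓ 1/2`
is forced — consistent with the crux, which allows off-line zeros with `Re ρ → 1/2`. [folklore] -/
theorem not_noRightInteriorBand_uniform :
    ¬ ∃ ε : ℝ, 0 < ε ∧ ∀ σ₀ : ℝ, 1 / 2 < σ₀ → σ₀ < 1 →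
        {s : ℂ | riemannZeta s = 0 ∧ 0 < s.re ∧ s.re < 1 ∧ |s.re - σ₀| < ε}.Finite := by
  rintro ⟨ε, hε, h⟩
  have hm1 : min (ε / 2) (1 / 4) ≤ ε / 2 := min_le_left _ _
  have hm2 : min (ε / 2) (1 / 4) ≤ 1 / 4 := min_le_right _ _
  have hm0 : 0 < min (ε / 2) (1 / 4) := lt_min (by linarith) (by norm_num)
  refine window_infinite_of_reaches_half (σ₀ := 1 / 2 + min (ε / 2) (1 / 4)) (ε := ε) ?_
    (h _ (by linarith) (by linarith))
  rw [abs_sub_lt_iff]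
  exact ⟨by linarith, by linarith⟩

/-- SHARPENING "finitely many" TO "none" IS RH: empty windows around every `σ₀ ∈ (1/2, 1)` say
exactly that no zero of the open strip has `Re s > 1/2` (`QuasiRiemannHypothesis (1/2)`), which is
Mathlib's `RiemannHypothesis` (reflection; PROVED in tree as
`quasiRiemannHypothesis_one_half_iff_holds`). Stub 1 is RH with "no zero" relaxed to "finitely
many zeros", window by window — that relaxation is the entire distance between them. [folklore] -/
theorem emptyWindows_iff_riemannHypothesis :
    (∀ σ₀ : ℝ, 1 / 2 < σ₀ → σ₀ < 1 → ∃ ε : ℝ, 0 < ε ∧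
        {s : ℂ | riemannZeta s = 0 ∧ 0 < s.re ∧ s.re < 1 ∧ |s.re - σ₀| < ε} = ∅) ↔
      RiemannHypothesis := by
  have e : Literature.NumberTheory.LFunctions.QuasiRiemannHypothesis (1 / 2) ↔ RiemannHypothesis :=
    Literature.NumberTheory.LFunctions.quasiRiemannHypothesis_one_half_iff_holds
  rw [← e, Literature.NumberTheory.LFunctions.QuasiRiemannHypothesis]
  constructor
  · intro h w hw hlt hw1
    obtain ⟨ε, hε, hempty⟩ := h w.re hlt hw1
    have hmem : w ∈ {s : ℂ | riemannZeta s = 0 ∧ 0 < s.re ∧ s.re < 1 ∧ |s.re - w.re| < ε} :=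
      ⟨hw, by linarith, hw1, by simpa using hε⟩
    rw [hempty] at hmem
    exact hmem
  · intro h σ₀ hσ _
    refine ⟨σ₀ - 1 / 2, by linarith, eq_empty_iff_forall_notMem.2 ?_⟩
    rintro s ⟨hz, _, h1, hs⟩
    rw [abs_sub_lt_iff] at hs
    exact h s hz (by linarith [hs.2]) h1

/-- A window is finite iff its zeros have bounded height (the zeros of `ζ` in a compact set are
finitely many, Mathlib `IsCompact.inter_riemannZetaZeros_finite`). [folklore] -/
theorem window_finite_iff_bounded (σ₀ ε : ℝ) :
    {s : ℂ | riemannZeta s = 0 ∧ 0 < s.re ∧ s.re < 1 ∧ |s.re - σ₀| < ε}.Finite ↔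
      ∃ T : ℝ, ∀ s ∈ {s : ℂ | riemannZeta s = 0 ∧ 0 < s.re ∧ s.re < 1 ∧ |s.re - σ₀| < ε}, |s.im| ≤ T := by
  constructor
  · intro h
    obtain ⟨T, hT⟩ := (h.image fun s : ℂ => |s.im|).bddAbove
    exact ⟨T, fun s hs => hT ⟨s, hs, rfl⟩⟩
  · rintro ⟨T, hT⟩
    refine (((isCompact_Icc (a := (0 : ℝ)) (b := 1)).reProdIm
      (isCompact_Icc (a := -T) (b := T))).inter_riemannZetaZeros_finite).subset ?_
    intro s hs
    have hs' := hs
    obtain ⟨hz, h0, h1, _⟩ := hs'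
    exact ⟨Complex.mem_reProdIm.2 ⟨⟨h0.le, h1.le⟩, abs_le.1 (hT s hs)⟩, hz⟩

/-- Converse of `StubProfile.eventually_zeroFree_of_window_finite` (NO PARTIAL CREDIT at a single
abscissa): an eventual zero-free VERTICAL NEIGHBOURHOOD `{|Re s − σ₀| < ε, |Im s| > T}` makes the
window finite. So stub 1 ⟺ "for every `σ₀ ∈ (1/2, 1)` some vertical neighbourhood of `σ₀` is
zero-free above some height" — an eventual quasi-RH on vertical neighbourhoods, each instance of
which lies beyond every zero-free region in print (all of width `→ 0` towards `Re s = 1`). [folklore] -/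
theorem window_finite_of_eventually_zeroFree {σ₀ ε T : ℝ}
    (h : ∀ s : ℂ, 0 < s.re → s.re < 1 → |s.re - σ₀| < ε → T < |s.im| → riemannZeta s ≠ 0) :
    {s : ℂ | riemannZeta s = 0 ∧ 0 < s.re ∧ s.re < 1 ∧ |s.re - σ₀| < ε}.Finite :=
  (window_finite_iff_bounded σ₀ ε).2
    ⟨T, fun s hs => not_lt.1 fun hT => h s hs.2.1 hs.2.2.1 hs.2.2.2 hT hs.1⟩

/-! ## 2. Stub 2 `stub_edgeZeroFreeStrip` (= route Strip's crux `StripZeroFreeStrip` = `Split.EdgeZeroFreeShape riemannZeta`, both `Iff.rfl`) -/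

/-- `Re s < 1` is REDUNDANT (Mathlib `riemannZeta_ne_zero_of_one_le_re`, which also covers
Mathlib's junk point `s = 1`). [folklore] -/
theorem edgeZeroFreeStrip_iff_without_reLtOne :
    (∃ δ : ℝ, 0 < δ ∧ ∀ s : ℂ, riemannZeta s = 0 → 1 - δ < s.re → s.re < 1 → False) ↔
      ∃ δ : ℝ, 0 < δ ∧ ∀ s : ℂ, riemannZeta s = 0 → 1 - δ < s.re → False := by
  refine exists_congr fun δ => and_congr_right fun _ =>
    ⟨fun h s hz hlo => ?_, fun h s hz hlo _ => h s hz hlo⟩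
  by_cases h1 : s.re < 1
  · exact h s hz hlo h1
  · exact riemannZeta_ne_zero_of_one_le_re (not_lt.1 h1) hz

/-- `0 < δ` carries the content: for `δ ≤ 0` the matrix of stub 2 holds vacuously. [folklore] -/
theorem edgeStrip_of_nonpos {δ : ℝ} (hδ : δ ≤ 0) :
    ∀ s : ℂ, riemannZeta s = 0 → 1 - δ < s.re → s.re < 1 → False :=
  fun _ _ hlo hhi => by linarith

/-- TIGHT RANGE OF THE PARAMETER: an admissible `δ` is at most `1/2` — a critical zero exists
(Hardy), and `δ > 1/2` would put the critical line inside the strip. [folklore] -/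
theorem edgeStrip_delta_le_half {δ : ℝ}
    (h : ∀ s : ℂ, riemannZeta s = 0 → 1 - δ < s.re → s.re < 1 → False) : δ ≤ 1 / 2 := by
  by_contra hδ
  push Not at hδ
  obtain ⟨_, ⟨t, ht, rfl⟩⟩ := critZeros_infinite.nonempty
  exact h _ ht (by rw [critPt_re]; linarith) (by rw [critPt_re]; norm_num)

/-- … and the endpoint `δ = 1/2` is RH itself (`QuasiRiemannHypothesis (1/2) ↔ RiemannHypothesis`,
PROVED in tree: `quasiRiemannHypothesis_one_half_iff_holds`). So stub 2 reads "quasi-RH at SOME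
abscissa `1 − δ ∈ [1/2, 1)`": each instance open, the endpoint RH, and nothing proved below it but
zero-free regions of width `→ 0`. [folklore] -/
theorem edgeStrip_half_iff_riemannHypothesis :
    (∀ s : ℂ, riemannZeta s = 0 → 1 / 2 < s.re → s.re < 1 → False) ↔ RiemannHypothesis :=
  Literature.NumberTheory.LFunctions.quasiRiemannHypothesis_one_half_iff_holds

/-- WEAKENING "no zero" TO "finitely many zeros" in an edge strip changes nothing: a finite
exceptional set has a largest real part `< 1`; shrink `δ` below it (`Set.exists_max_image`; the
argument of the route's support `AsymptoticToZeroFreeStrip`). There is no finite-exception rung on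
the edge side. [folklore] -/
theorem edgeFinite_iff_edgeZeroFreeStrip :
    (∃ δ : ℝ, 0 < δ ∧ {s : ℂ | riemannZeta s = 0 ∧ 1 - δ < s.re ∧ s.re < 1}.Finite) ↔
      ∃ δ : ℝ, 0 < δ ∧ ∀ s : ℂ, riemannZeta s = 0 → 1 - δ < s.re → s.re < 1 → False := by
  constructor
  · rintro ⟨δ, hδ, hfin⟩
    by_cases hne : ({s : ℂ | riemannZeta s = 0 ∧ 1 - δ < s.re ∧ s.re < 1}).Nonempty
    · obtain ⟨a, haF, hmax⟩ := Set.exists_max_image _ (fun s : ℂ => s.re) hfin hne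
      obtain ⟨-, ha0, ha1⟩ := haF
      refine ⟨1 - a.re, by linarith, fun s hz hlo hhi => ?_⟩
      have hsa : s.re ≤ a.re := hmax s ⟨hz, by linarith, hhi⟩
      linarith
    · exact ⟨δ, hδ, fun s hz hlo hhi => hne ⟨s, hz, hlo, hhi⟩⟩
  · rintro ⟨δ, hδ, h⟩
    refine ⟨δ, hδ, ?_⟩
    have he : {s : ℂ | riemannZeta s = 0 ∧ 1 - δ < s.re ∧ s.re < 1} = ∅ :=
      eq_empty_iff_forall_notMem.2 fun s hs => h s hs.1 hs.2.1 hs.2.2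
    rw [he]
    exact finite_empty

/-- THE MISSING ABSCISSA: stub 1's matrix AT `σ₀ = 1` (a finite window at the edge) is exactly
stub 2. Together with `noRightInteriorBand_without_ltOne_iff_acl` this is the split read off the
parameter line: crux = stub-1-matrix on `(1/2, 1]`, stub 1 = on `(1/2, 1)`, stub 2 = at `{1}`.
[folklore] -/
theorem windowOne_iff_edgeZeroFreeStrip :
    (∃ δ : ℝ, 0 < δ ∧ {s : ℂ | riemannZeta s = 0 ∧ 0 < s.re ∧ s.re < 1 ∧ |s.re - 1| < δ}.Finite) ↔
      ∃ δ : ℝ, 0 < δ ∧ ∀ s : ℂ, riemannZeta s = 0 → 1 - δ < s.re → s.re < 1 → False := by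
  rw [← edgeFinite_iff_edgeZeroFreeStrip]
  constructor
  · rintro ⟨δ, hδ, hfin⟩
    have hm1 : min δ (1 / 2) ≤ δ := min_le_left _ _
    have hm2 : min δ (1 / 2) ≤ 1 / 2 := min_le_right _ _
    refine ⟨min δ (1 / 2), lt_min hδ (by norm_num), hfin.subset ?_⟩
    rintro s ⟨hz, hlo, hhi⟩
    refine ⟨hz, by linarith, hhi, ?_⟩
    rw [abs_sub_lt_iff]
    exact ⟨by linarith, by linarith⟩
  · rintro ⟨δ, hδ, hfin⟩
    refine ⟨δ, hδ, hfin.subset ?_⟩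
    rintro s ⟨hz, _, hhi, hs⟩
    rw [abs_sub_lt_iff] at hs
    exact ⟨hz, by linarith [hs.2], hhi⟩


/-! ## 3. The composition needs BOTH stubs: an abstract zero set marching to the edge -/

/-- Zeros marching to the 1-line: `e_n = 1 − 2^{−(n+2)} + i n` (real parts `3/4, 7/8, 15/16, … → 1`,
heights `n → ∞`). [folklore] -/
def edgePt (n : ℕ) : ℂ :=
  (((1 : ℝ) - (1 / 2) ^ (n + 2) : ℝ) : ℂ) + (n : ℂ) * I

/-- [folklore] -/
theorem edgePt_re (n : ℕ) : (edgePt n).re = 1 - (1 / 2) ^ (n + 2) := by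
  simp only [edgePt, add_re, ofReal_re, mul_re, natCast_re, natCast_im, I_re, I_im, mul_zero,
    zero_mul, sub_zero, add_zero]

/-- [folklore] -/
theorem edgePt_im (n : ℕ) : (edgePt n).im = n := by
  simp only [edgePt, add_im, ofReal_im, mul_im, natCast_re, natCast_im, I_re, I_im, mul_one,
    mul_zero, add_zero, zero_add]

/-- DROP STUB 2 AND THE COMPOSITION FAILS (abstract model, `Ladder.zeroSetFn`): for the zero set
`{e_n}` stub 1's shape HOLDS (a window around `σ₀ < 1` of radius `(1 − σ₀)/2` stays left of
`(1 + σ₀)/2` and meets only the finitely many `e_n` with `2^{−(n+2)} > (1 − σ₀)/2`) while stub 2's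
shape — hence the band shape of the crux — FAILS. Together with
`SplitWitness.exists_edge_and_not_noInterior` (the truncation `ζ₃`: stub 2's shape true, stub 1's
false) the two hypotheses of the line's `AsymptoticCriticalLine_of` are INDEPENDENT as shapes:
neither can be dropped for a general zero set (hypothesis mutation of the glue finds nothing
unnecessary); for `ζ` itself both are open and RH-implied. [folklore] -/
theorem exists_rightInterior_and_not_edge :
    ∃ Z : ℂ → ℂ,
      (∀ σ₀ : ℝ, 1 / 2 < σ₀ → σ₀ < 1 → ∃ ε : ℝ, 0 < ε ∧
          {s : ℂ | Z s = 0 ∧ 0 < s.re ∧ s.re < 1 ∧ |s.re - σ₀| < ε}.Finite) ∧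
      ¬ (∃ δ : ℝ, 0 < δ ∧ ∀ s : ℂ, Z s = 0 → 1 - δ < s.re → s.re < 1 → False) := by
  refine ⟨zeroSetFn (Set.range edgePt), fun σ₀ _ h1 => ?_, ?_⟩
  · obtain ⟨N, hN⟩ : ∃ N : ℕ, ((1 : ℝ) / 2) ^ (N + 2) < (1 - σ₀) / 2 := by
      obtain ⟨N, hN⟩ := exists_pow_lt_of_lt_one (show 0 < (1 - σ₀) / 2 by linarith)
        (show (1 : ℝ) / 2 < 1 by norm_num)
      exact ⟨N, lt_of_le_of_lt (pow_le_pow_of_le_one (by norm_num) (by norm_num) (by omega)) hN⟩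
    refine ⟨(1 - σ₀) / 2, by linarith, ((Finset.range N).finite_toSet.image edgePt).subset ?_⟩
    rintro s ⟨hz, -, -, hs⟩
    rw [zeroSetFn_eq_zero_iff] at hz
    obtain ⟨n, rfl⟩ := hz
    refine ⟨n, ?_, rfl⟩
    rw [Finset.coe_range, Set.mem_Iio]
    by_contra hn
    push Not at hn
    rw [abs_sub_lt_iff, edgePt_re] at hs
    have hmono : ((1 : ℝ) / 2) ^ (n + 2) ≤ (1 / 2) ^ (N + 2) :=
      pow_le_pow_of_le_one (by norm_num) (by norm_num) (by omega)
    linarith [hs.1, hs.2]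
  · rintro ⟨δ, hδ, h⟩
    obtain ⟨n, hn⟩ := exists_pow_lt_of_lt_one hδ (show (1 : ℝ) / 2 < 1 by norm_num)
    have hle : ((1 : ℝ) / 2) ^ (n + 2) ≤ (1 / 2) ^ n :=
      pow_le_pow_of_le_one (by norm_num) (by norm_num) (by omega)
    have hpos : (0 : ℝ) < (1 / 2) ^ (n + 2) := by positivity
    refine h (edgePt n) ((zeroSetFn_eq_zero_iff _ _).2 ⟨n, rfl⟩) ?_ ?_
    · rw [edgePt_re]; linarith
    · rw [edgePt_re]; linarith

end Summit.RiemannHypothesis.RiemannHypothesis.Theorems.AsymptoticCriticalLine.Negative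

end
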